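import Summits.CriticalPhenomena.PercolationContinuityZ3.Theorems.Transplant.FKConnectivityAllQPat3RingStarData2
import HarnessLib

/-!
# Connectivity correlation inequalities for `φ_{w,q}`, every `q > 0` — THEOREM SP DATA: the RING certificate for `starXTab`,
# part 3 of 3 (Stage S2 data file; 131 products, denominator 16; 125 row-sized kernel evaluations over three files)

Theorems + data file (`--supports stmt-CriticalPhenomena-4575`), census lane `prim-bschramm-census` (gen 36) of the post-continuity programme (LANE 2 bschramm, FK sub-lane);
builds on p205010 (kernel theorem, internal audit signed; external expert review pending).
No named facts, no sorries; standard axioms (`decide +kernel` only: kernel evaluation, no compiled evaluation).  Census g34's RING certificate for the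
target `starXTab` re-derived by LP in ordered pattern tables (131 products), checked by the kernel through `FK.rowG` in 125 small
declarations (rows `(P_K, Q_K, P_1)`; per-declaration memory sized for the smaller farm nodes), `FK.loop1G_of_rows`, and assembled
in part 3 by `FK.symCert_of_pairs` into **`FK.ringStar_level_nonneg`**.
[cite: AyyerLinussonRavichandran2025, §7 eq. (13)–(15) (p. 22)] [cite: Grimmett2006, §3.8 (pp. 61–62)]
-/

noncomputable section

namespace Summit.CriticalPhenomena.PercolationContinuityZ3.Theorems

namespace FK

open SimpleGraph Literature.Probability.LatticeModels Literature.Probability.Percolation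

section Data

/- Sequential elaboration: the kernel evaluations below must not run concurrently (memory on the smaller farm nodes;
census g36 measured: 50 concurrent row evaluations are killed, sequential ones take ≈ 5 s each). -/
set_option Elab.async false

open scoped Classical

variable {V : Type*} [Fintype V]

/-! ### Row checks, part 3, and assembly -/

/-- Row `(ys_x, all, all)` of the RingStar certificate check (kernel evaluation). [folklore] -/
theorem ringStar_row_ys_x_all_all :
    rowG tauRingStar 8 16 2 (prodsLRingStar.filter fun p => suppAt p.gK Pat3.ys_x Pat3.all) Pat3.ys_x Pat3.all Pat3.all = true := by
  decide +kernel

/-- Row `(ys_x, all, xy_s)` of the RingStar certificate check (kernel evaluation). [folklore] -/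
theorem ringStar_row_ys_x_all_xy_s :
    rowG tauRingStar 8 16 2 (prodsLRingStar.filter fun p => suppAt p.gK Pat3.ys_x Pat3.all) Pat3.ys_x Pat3.all Pat3.xy_s = true := by
  decide +kernel

/-- Row `(ys_x, all, xs_y)` of the RingStar certificate check (kernel evaluation). [folklore] -/
theorem ringStar_row_ys_x_all_xs_y :
    rowG tauRingStar 8 16 2 (prodsLRingStar.filter fun p => suppAt p.gK Pat3.ys_x Pat3.all) Pat3.ys_x Pat3.all Pat3.xs_y = true := by
  decide +kernel

/-- Row `(ys_x, all, ys_x)` of the RingStar certificate check (kernel evaluation). [folklore] -/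
theorem ringStar_row_ys_x_all_ys_x :
    rowG tauRingStar 8 16 2 (prodsLRingStar.filter fun p => suppAt p.gK Pat3.ys_x Pat3.all) Pat3.ys_x Pat3.all Pat3.ys_x = true := by
  decide +kernel

/-- Row `(ys_x, all, sep)` of the RingStar certificate check (kernel evaluation). [folklore] -/
theorem ringStar_row_ys_x_all_sep :
    rowG tauRingStar 8 16 2 (prodsLRingStar.filter fun p => suppAt p.gK Pat3.ys_x Pat3.all) Pat3.ys_x Pat3.all Pat3.sep = true := by
  decide +kernel

/-- Row `(ys_x, xy_s, all)` of the RingStar certificate check (kernel evaluation). [folklore] -/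
theorem ringStar_row_ys_x_xy_s_all :
    rowG tauRingStar 8 16 2 (prodsLRingStar.filter fun p => suppAt p.gK Pat3.ys_x Pat3.xy_s) Pat3.ys_x Pat3.xy_s Pat3.all = true := by
  decide +kernel

/-- Row `(ys_x, xy_s, xy_s)` of the RingStar certificate check (kernel evaluation). [folklore] -/
theorem ringStar_row_ys_x_xy_s_xy_s :
    rowG tauRingStar 8 16 2 (prodsLRingStar.filter fun p => suppAt p.gK Pat3.ys_x Pat3.xy_s) Pat3.ys_x Pat3.xy_s Pat3.xy_s = true := by
  decide +kernel

/-- Row `(ys_x, xy_s, xs_y)` of the RingStar certificate check (kernel evaluation). [folklore] -/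
theorem ringStar_row_ys_x_xy_s_xs_y :
    rowG tauRingStar 8 16 2 (prodsLRingStar.filter fun p => suppAt p.gK Pat3.ys_x Pat3.xy_s) Pat3.ys_x Pat3.xy_s Pat3.xs_y = true := by
  decide +kernel

/-- Row `(ys_x, xy_s, ys_x)` of the RingStar certificate check (kernel evaluation). [folklore] -/
theorem ringStar_row_ys_x_xy_s_ys_x :
    rowG tauRingStar 8 16 2 (prodsLRingStar.filter fun p => suppAt p.gK Pat3.ys_x Pat3.xy_s) Pat3.ys_x Pat3.xy_s Pat3.ys_x = true := by
  decide +kernel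

/-- Row `(ys_x, xy_s, sep)` of the RingStar certificate check (kernel evaluation). [folklore] -/
theorem ringStar_row_ys_x_xy_s_sep :
    rowG tauRingStar 8 16 2 (prodsLRingStar.filter fun p => suppAt p.gK Pat3.ys_x Pat3.xy_s) Pat3.ys_x Pat3.xy_s Pat3.sep = true := by
  decide +kernel

/-- Row `(ys_x, xs_y, all)` of the RingStar certificate check (kernel evaluation). [folklore] -/
theorem ringStar_row_ys_x_xs_y_all :
    rowG tauRingStar 8 16 2 (prodsLRingStar.filter fun p => suppAt p.gK Pat3.ys_x Pat3.xs_y) Pat3.ys_x Pat3.xs_y Pat3.all = true := by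
  decide +kernel

/-- Row `(ys_x, xs_y, xy_s)` of the RingStar certificate check (kernel evaluation). [folklore] -/
theorem ringStar_row_ys_x_xs_y_xy_s :
    rowG tauRingStar 8 16 2 (prodsLRingStar.filter fun p => suppAt p.gK Pat3.ys_x Pat3.xs_y) Pat3.ys_x Pat3.xs_y Pat3.xy_s = true := by
  decide +kernel

/-- Row `(ys_x, xs_y, xs_y)` of the RingStar certificate check (kernel evaluation). [folklore] -/
theorem ringStar_row_ys_x_xs_y_xs_y :
    rowG tauRingStar 8 16 2 (prodsLRingStar.filter fun p => suppAt p.gK Pat3.ys_x Pat3.xs_y) Pat3.ys_x Pat3.xs_y Pat3.xs_y = true := by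
  decide +kernel

/-- Row `(ys_x, xs_y, ys_x)` of the RingStar certificate check (kernel evaluation). [folklore] -/
theorem ringStar_row_ys_x_xs_y_ys_x :
    rowG tauRingStar 8 16 2 (prodsLRingStar.filter fun p => suppAt p.gK Pat3.ys_x Pat3.xs_y) Pat3.ys_x Pat3.xs_y Pat3.ys_x = true := by
  decide +kernel

/-- Row `(ys_x, xs_y, sep)` of the RingStar certificate check (kernel evaluation). [folklore] -/
theorem ringStar_row_ys_x_xs_y_sep :
    rowG tauRingStar 8 16 2 (prodsLRingStar.filter fun p => suppAt p.gK Pat3.ys_x Pat3.xs_y) Pat3.ys_x Pat3.xs_y Pat3.sep = true := by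
  decide +kernel

/-- Row `(ys_x, ys_x, all)` of the RingStar certificate check (kernel evaluation). [folklore] -/
theorem ringStar_row_ys_x_ys_x_all :
    rowG tauRingStar 8 16 2 (prodsLRingStar.filter fun p => suppAt p.gK Pat3.ys_x Pat3.ys_x) Pat3.ys_x Pat3.ys_x Pat3.all = true := by
  decide +kernel

/-- Row `(ys_x, ys_x, xy_s)` of the RingStar certificate check (kernel evaluation). [folklore] -/
theorem ringStar_row_ys_x_ys_x_xy_s :
    rowG tauRingStar 8 16 2 (prodsLRingStar.filter fun p => suppAt p.gK Pat3.ys_x Pat3.ys_x) Pat3.ys_x Pat3.ys_x Pat3.xy_s = true := by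
  decide +kernel

/-- Row `(ys_x, ys_x, xs_y)` of the RingStar certificate check (kernel evaluation). [folklore] -/
theorem ringStar_row_ys_x_ys_x_xs_y :
    rowG tauRingStar 8 16 2 (prodsLRingStar.filter fun p => suppAt p.gK Pat3.ys_x Pat3.ys_x) Pat3.ys_x Pat3.ys_x Pat3.xs_y = true := by
  decide +kernel

/-- Row `(ys_x, ys_x, ys_x)` of the RingStar certificate check (kernel evaluation). [folklore] -/
theorem ringStar_row_ys_x_ys_x_ys_x :
    rowG tauRingStar 8 16 2 (prodsLRingStar.filter fun p => suppAt p.gK Pat3.ys_x Pat3.ys_x) Pat3.ys_x Pat3.ys_x Pat3.ys_x = true := by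
  decide +kernel

/-- Row `(ys_x, ys_x, sep)` of the RingStar certificate check (kernel evaluation). [folklore] -/
theorem ringStar_row_ys_x_ys_x_sep :
    rowG tauRingStar 8 16 2 (prodsLRingStar.filter fun p => suppAt p.gK Pat3.ys_x Pat3.ys_x) Pat3.ys_x Pat3.ys_x Pat3.sep = true := by
  decide +kernel

/-- Row `(ys_x, sep, all)` of the RingStar certificate check (kernel evaluation). [folklore] -/
theorem ringStar_row_ys_x_sep_all :
    rowG tauRingStar 8 16 2 (prodsLRingStar.filter fun p => suppAt p.gK Pat3.ys_x Pat3.sep) Pat3.ys_x Pat3.sep Pat3.all = true := by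
  decide +kernel

/-- Row `(ys_x, sep, xy_s)` of the RingStar certificate check (kernel evaluation). [folklore] -/
theorem ringStar_row_ys_x_sep_xy_s :
    rowG tauRingStar 8 16 2 (prodsLRingStar.filter fun p => suppAt p.gK Pat3.ys_x Pat3.sep) Pat3.ys_x Pat3.sep Pat3.xy_s = true := by
  decide +kernel

/-- Row `(ys_x, sep, xs_y)` of the RingStar certificate check (kernel evaluation). [folklore] -/
theorem ringStar_row_ys_x_sep_xs_y :
    rowG tauRingStar 8 16 2 (prodsLRingStar.filter fun p => suppAt p.gK Pat3.ys_x Pat3.sep) Pat3.ys_x Pat3.sep Pat3.xs_y = true := by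
  decide +kernel

/-- Row `(ys_x, sep, ys_x)` of the RingStar certificate check (kernel evaluation). [folklore] -/
theorem ringStar_row_ys_x_sep_ys_x :
    rowG tauRingStar 8 16 2 (prodsLRingStar.filter fun p => suppAt p.gK Pat3.ys_x Pat3.sep) Pat3.ys_x Pat3.sep Pat3.ys_x = true := by
  decide +kernel

/-- Row `(ys_x, sep, sep)` of the RingStar certificate check (kernel evaluation). [folklore] -/
theorem ringStar_row_ys_x_sep_sep :
    rowG tauRingStar 8 16 2 (prodsLRingStar.filter fun p => suppAt p.gK Pat3.ys_x Pat3.sep) Pat3.ys_x Pat3.sep Pat3.sep = true := by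
  decide +kernel

/-- Row `(sep, all, all)` of the RingStar certificate check (kernel evaluation). [folklore] -/
theorem ringStar_row_sep_all_all :
    rowG tauRingStar 8 16 2 (prodsLRingStar.filter fun p => suppAt p.gK Pat3.sep Pat3.all) Pat3.sep Pat3.all Pat3.all = true := by
  decide +kernel

/-- Row `(sep, all, xy_s)` of the RingStar certificate check (kernel evaluation). [folklore] -/
theorem ringStar_row_sep_all_xy_s :
    rowG tauRingStar 8 16 2 (prodsLRingStar.filter fun p => suppAt p.gK Pat3.sep Pat3.all) Pat3.sep Pat3.all Pat3.xy_s = true := by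
  decide +kernel

/-- Row `(sep, all, xs_y)` of the RingStar certificate check (kernel evaluation). [folklore] -/
theorem ringStar_row_sep_all_xs_y :
    rowG tauRingStar 8 16 2 (prodsLRingStar.filter fun p => suppAt p.gK Pat3.sep Pat3.all) Pat3.sep Pat3.all Pat3.xs_y = true := by
  decide +kernel

/-- Row `(sep, all, ys_x)` of the RingStar certificate check (kernel evaluation). [folklore] -/
theorem ringStar_row_sep_all_ys_x :
    rowG tauRingStar 8 16 2 (prodsLRingStar.filter fun p => suppAt p.gK Pat3.sep Pat3.all) Pat3.sep Pat3.all Pat3.ys_x = true := by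
  decide +kernel

/-- Row `(sep, all, sep)` of the RingStar certificate check (kernel evaluation). [folklore] -/
theorem ringStar_row_sep_all_sep :
    rowG tauRingStar 8 16 2 (prodsLRingStar.filter fun p => suppAt p.gK Pat3.sep Pat3.all) Pat3.sep Pat3.all Pat3.sep = true := by
  decide +kernel

/-- Row `(sep, xy_s, all)` of the RingStar certificate check (kernel evaluation). [folklore] -/
theorem ringStar_row_sep_xy_s_all :
    rowG tauRingStar 8 16 2 (prodsLRingStar.filter fun p => suppAt p.gK Pat3.sep Pat3.xy_s) Pat3.sep Pat3.xy_s Pat3.all = true := by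
  decide +kernel

/-- Row `(sep, xy_s, xy_s)` of the RingStar certificate check (kernel evaluation). [folklore] -/
theorem ringStar_row_sep_xy_s_xy_s :
    rowG tauRingStar 8 16 2 (prodsLRingStar.filter fun p => suppAt p.gK Pat3.sep Pat3.xy_s) Pat3.sep Pat3.xy_s Pat3.xy_s = true := by
  decide +kernel

/-- Row `(sep, xy_s, xs_y)` of the RingStar certificate check (kernel evaluation). [folklore] -/
theorem ringStar_row_sep_xy_s_xs_y :
    rowG tauRingStar 8 16 2 (prodsLRingStar.filter fun p => suppAt p.gK Pat3.sep Pat3.xy_s) Pat3.sep Pat3.xy_s Pat3.xs_y = true := by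
  decide +kernel

/-- Row `(sep, xy_s, ys_x)` of the RingStar certificate check (kernel evaluation). [folklore] -/
theorem ringStar_row_sep_xy_s_ys_x :
    rowG tauRingStar 8 16 2 (prodsLRingStar.filter fun p => suppAt p.gK Pat3.sep Pat3.xy_s) Pat3.sep Pat3.xy_s Pat3.ys_x = true := by
  decide +kernel

/-- Row `(sep, xy_s, sep)` of the RingStar certificate check (kernel evaluation). [folklore] -/
theorem ringStar_row_sep_xy_s_sep :
    rowG tauRingStar 8 16 2 (prodsLRingStar.filter fun p => suppAt p.gK Pat3.sep Pat3.xy_s) Pat3.sep Pat3.xy_s Pat3.sep = true := by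
  decide +kernel

/-- Row `(sep, xs_y, all)` of the RingStar certificate check (kernel evaluation). [folklore] -/
theorem ringStar_row_sep_xs_y_all :
    rowG tauRingStar 8 16 2 (prodsLRingStar.filter fun p => suppAt p.gK Pat3.sep Pat3.xs_y) Pat3.sep Pat3.xs_y Pat3.all = true := by
  decide +kernel

/-- Row `(sep, xs_y, xy_s)` of the RingStar certificate check (kernel evaluation). [folklore] -/
theorem ringStar_row_sep_xs_y_xy_s :
    rowG tauRingStar 8 16 2 (prodsLRingStar.filter fun p => suppAt p.gK Pat3.sep Pat3.xs_y) Pat3.sep Pat3.xs_y Pat3.xy_s = true := by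
  decide +kernel

/-- Row `(sep, xs_y, xs_y)` of the RingStar certificate check (kernel evaluation). [folklore] -/
theorem ringStar_row_sep_xs_y_xs_y :
    rowG tauRingStar 8 16 2 (prodsLRingStar.filter fun p => suppAt p.gK Pat3.sep Pat3.xs_y) Pat3.sep Pat3.xs_y Pat3.xs_y = true := by
  decide +kernel

/-- Row `(sep, xs_y, ys_x)` of the RingStar certificate check (kernel evaluation). [folklore] -/
theorem ringStar_row_sep_xs_y_ys_x :
    rowG tauRingStar 8 16 2 (prodsLRingStar.filter fun p => suppAt p.gK Pat3.sep Pat3.xs_y) Pat3.sep Pat3.xs_y Pat3.ys_x = true := by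
  decide +kernel

/-- Row `(sep, xs_y, sep)` of the RingStar certificate check (kernel evaluation). [folklore] -/
theorem ringStar_row_sep_xs_y_sep :
    rowG tauRingStar 8 16 2 (prodsLRingStar.filter fun p => suppAt p.gK Pat3.sep Pat3.xs_y) Pat3.sep Pat3.xs_y Pat3.sep = true := by
  decide +kernel

/-- Row `(sep, ys_x, all)` of the RingStar certificate check (kernel evaluation). [folklore] -/
theorem ringStar_row_sep_ys_x_all :
    rowG tauRingStar 8 16 2 (prodsLRingStar.filter fun p => suppAt p.gK Pat3.sep Pat3.ys_x) Pat3.sep Pat3.ys_x Pat3.all = true := by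
  decide +kernel

/-- Row `(sep, ys_x, xy_s)` of the RingStar certificate check (kernel evaluation). [folklore] -/
theorem ringStar_row_sep_ys_x_xy_s :
    rowG tauRingStar 8 16 2 (prodsLRingStar.filter fun p => suppAt p.gK Pat3.sep Pat3.ys_x) Pat3.sep Pat3.ys_x Pat3.xy_s = true := by
  decide +kernel

/-- Row `(sep, ys_x, xs_y)` of the RingStar certificate check (kernel evaluation). [folklore] -/
theorem ringStar_row_sep_ys_x_xs_y :
    rowG tauRingStar 8 16 2 (prodsLRingStar.filter fun p => suppAt p.gK Pat3.sep Pat3.ys_x) Pat3.sep Pat3.ys_x Pat3.xs_y = true := by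
  decide +kernel

/-- Row `(sep, ys_x, ys_x)` of the RingStar certificate check (kernel evaluation). [folklore] -/
theorem ringStar_row_sep_ys_x_ys_x :
    rowG tauRingStar 8 16 2 (prodsLRingStar.filter fun p => suppAt p.gK Pat3.sep Pat3.ys_x) Pat3.sep Pat3.ys_x Pat3.ys_x = true := by
  decide +kernel

/-- Row `(sep, ys_x, sep)` of the RingStar certificate check (kernel evaluation). [folklore] -/
theorem ringStar_row_sep_ys_x_sep :
    rowG tauRingStar 8 16 2 (prodsLRingStar.filter fun p => suppAt p.gK Pat3.sep Pat3.ys_x) Pat3.sep Pat3.ys_x Pat3.sep = true := by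
  decide +kernel

/-- Row `(sep, sep, all)` of the RingStar certificate check (kernel evaluation). [folklore] -/
theorem ringStar_row_sep_sep_all :
    rowG tauRingStar 8 16 2 (prodsLRingStar.filter fun p => suppAt p.gK Pat3.sep Pat3.sep) Pat3.sep Pat3.sep Pat3.all = true := by
  decide +kernel

/-- Row `(sep, sep, xy_s)` of the RingStar certificate check (kernel evaluation). [folklore] -/
theorem ringStar_row_sep_sep_xy_s :
    rowG tauRingStar 8 16 2 (prodsLRingStar.filter fun p => suppAt p.gK Pat3.sep Pat3.sep) Pat3.sep Pat3.sep Pat3.xy_s = true := by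
  decide +kernel

/-- Row `(sep, sep, xs_y)` of the RingStar certificate check (kernel evaluation). [folklore] -/
theorem ringStar_row_sep_sep_xs_y :
    rowG tauRingStar 8 16 2 (prodsLRingStar.filter fun p => suppAt p.gK Pat3.sep Pat3.sep) Pat3.sep Pat3.sep Pat3.xs_y = true := by
  decide +kernel

/-- Row `(sep, sep, ys_x)` of the RingStar certificate check (kernel evaluation). [folklore] -/
theorem ringStar_row_sep_sep_ys_x :
    rowG tauRingStar 8 16 2 (prodsLRingStar.filter fun p => suppAt p.gK Pat3.sep Pat3.sep) Pat3.sep Pat3.sep Pat3.ys_x = true := by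
  decide +kernel

/-- Row `(sep, sep, sep)` of the RingStar certificate check (kernel evaluation). [folklore] -/
theorem ringStar_row_sep_sep_sep :
    rowG tauRingStar 8 16 2 (prodsLRingStar.filter fun p => suppAt p.gK Pat3.sep Pat3.sep) Pat3.sep Pat3.sep Pat3.sep = true := by
  decide +kernel

/-- Pair `(ys_x, all)` of the RingStar certificate check, from its five rows. [folklore] -/
theorem ringStar_pair_ys_x_all : loop1G tauRingStar 8 16 2 (prodsLRingStar.filter fun p => suppAt p.gK Pat3.ys_x Pat3.all) Pat3.ys_x Pat3.all = true :=
  loop1G_of_rows fun R => by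
    cases R; exacts [ringStar_row_ys_x_all_all, ringStar_row_ys_x_all_xy_s, ringStar_row_ys_x_all_xs_y, ringStar_row_ys_x_all_ys_x, ringStar_row_ys_x_all_sep]

/-- Pair `(ys_x, xy_s)` of the RingStar certificate check, from its five rows. [folklore] -/
theorem ringStar_pair_ys_x_xy_s : loop1G tauRingStar 8 16 2 (prodsLRingStar.filter fun p => suppAt p.gK Pat3.ys_x Pat3.xy_s) Pat3.ys_x Pat3.xy_s = true :=
  loop1G_of_rows fun R => by
    cases R; exacts [ringStar_row_ys_x_xy_s_all, ringStar_row_ys_x_xy_s_xy_s, ringStar_row_ys_x_xy_s_xs_y, ringStar_row_ys_x_xy_s_ys_x, ringStar_row_ys_x_xy_s_sep]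

/-- Pair `(ys_x, xs_y)` of the RingStar certificate check, from its five rows. [folklore] -/
theorem ringStar_pair_ys_x_xs_y : loop1G tauRingStar 8 16 2 (prodsLRingStar.filter fun p => suppAt p.gK Pat3.ys_x Pat3.xs_y) Pat3.ys_x Pat3.xs_y = true :=
  loop1G_of_rows fun R => by
    cases R; exacts [ringStar_row_ys_x_xs_y_all, ringStar_row_ys_x_xs_y_xy_s, ringStar_row_ys_x_xs_y_xs_y, ringStar_row_ys_x_xs_y_ys_x, ringStar_row_ys_x_xs_y_sep]

/-- Pair `(ys_x, ys_x)` of the RingStar certificate check, from its five rows. [folklore] -/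
theorem ringStar_pair_ys_x_ys_x : loop1G tauRingStar 8 16 2 (prodsLRingStar.filter fun p => suppAt p.gK Pat3.ys_x Pat3.ys_x) Pat3.ys_x Pat3.ys_x = true :=
  loop1G_of_rows fun R => by
    cases R; exacts [ringStar_row_ys_x_ys_x_all, ringStar_row_ys_x_ys_x_xy_s, ringStar_row_ys_x_ys_x_xs_y, ringStar_row_ys_x_ys_x_ys_x, ringStar_row_ys_x_ys_x_sep]

/-- Pair `(ys_x, sep)` of the RingStar certificate check, from its five rows. [folklore] -/
theorem ringStar_pair_ys_x_sep : loop1G tauRingStar 8 16 2 (prodsLRingStar.filter fun p => suppAt p.gK Pat3.ys_x Pat3.sep) Pat3.ys_x Pat3.sep = true :=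
  loop1G_of_rows fun R => by
    cases R; exacts [ringStar_row_ys_x_sep_all, ringStar_row_ys_x_sep_xy_s, ringStar_row_ys_x_sep_xs_y, ringStar_row_ys_x_sep_ys_x, ringStar_row_ys_x_sep_sep]

/-- Pair `(sep, all)` of the RingStar certificate check, from its five rows. [folklore] -/
theorem ringStar_pair_sep_all : loop1G tauRingStar 8 16 2 (prodsLRingStar.filter fun p => suppAt p.gK Pat3.sep Pat3.all) Pat3.sep Pat3.all = true :=
  loop1G_of_rows fun R => by
    cases R; exacts [ringStar_row_sep_all_all, ringStar_row_sep_all_xy_s, ringStar_row_sep_all_xs_y, ringStar_row_sep_all_ys_x, ringStar_row_sep_all_sep]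

/-- Pair `(sep, xy_s)` of the RingStar certificate check, from its five rows. [folklore] -/
theorem ringStar_pair_sep_xy_s : loop1G tauRingStar 8 16 2 (prodsLRingStar.filter fun p => suppAt p.gK Pat3.sep Pat3.xy_s) Pat3.sep Pat3.xy_s = true :=
  loop1G_of_rows fun R => by
    cases R; exacts [ringStar_row_sep_xy_s_all, ringStar_row_sep_xy_s_xy_s, ringStar_row_sep_xy_s_xs_y, ringStar_row_sep_xy_s_ys_x, ringStar_row_sep_xy_s_sep]

/-- Pair `(sep, xs_y)` of the RingStar certificate check, from its five rows. [folklore] -/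
theorem ringStar_pair_sep_xs_y : loop1G tauRingStar 8 16 2 (prodsLRingStar.filter fun p => suppAt p.gK Pat3.sep Pat3.xs_y) Pat3.sep Pat3.xs_y = true :=
  loop1G_of_rows fun R => by
    cases R; exacts [ringStar_row_sep_xs_y_all, ringStar_row_sep_xs_y_xy_s, ringStar_row_sep_xs_y_xs_y, ringStar_row_sep_xs_y_ys_x, ringStar_row_sep_xs_y_sep]

/-- Pair `(sep, ys_x)` of the RingStar certificate check, from its five rows. [folklore] -/
theorem ringStar_pair_sep_ys_x : loop1G tauRingStar 8 16 2 (prodsLRingStar.filter fun p => suppAt p.gK Pat3.sep Pat3.ys_x) Pat3.sep Pat3.ys_x = true :=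
  loop1G_of_rows fun R => by
    cases R; exacts [ringStar_row_sep_ys_x_all, ringStar_row_sep_ys_x_xy_s, ringStar_row_sep_ys_x_xs_y, ringStar_row_sep_ys_x_ys_x, ringStar_row_sep_ys_x_sep]

/-- Pair `(sep, sep)` of the RingStar certificate check, from its five rows. [folklore] -/
theorem ringStar_pair_sep_sep : loop1G tauRingStar 8 16 2 (prodsLRingStar.filter fun p => suppAt p.gK Pat3.sep Pat3.sep) Pat3.sep Pat3.sep = true :=
  loop1G_of_rows fun R => by
    cases R; exacts [ringStar_row_sep_sep_all, ringStar_row_sep_sep_xy_s, ringStar_row_sep_sep_xs_y, ringStar_row_sep_sep_ys_x, ringStar_row_sep_sep_sep]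

/-- **The symmetrised certificate family** `8 · Σ_j λ_j π_j ≤ 16 · target3Sym joinRing corrRing starXTab` at every level offset and cell. [folklore] -/
theorem ringStar_cert (d : ℕ) (PK QK P1 Q1 P2 Q2 : Pat3) :
    8 * ∑ j : Fin (prodsRingStar.map Prod3G.toProd3).length,
        (((prodsRingStar.map Prod3G.toProd3).get j).lam : ℤ) *
          ((prodsRingStar.map Prod3G.toProd3).get j).tensor d PK QK P1 Q1 P2 Q2 ≤
      (16 : ℕ) * target3Sym joinRing corrRing starXTab d PK QK P1 Q1 P2 Q2 :=
  symCert_of_pairs corrRing_le_two 16 2 ringStar_shift (fun PK QK => by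
    cases PK <;> cases QK
    exacts [ringStar_pair_all_all, ringStar_pair_all_xy_s, ringStar_pair_all_xs_y, ringStar_pair_all_ys_x, ringStar_pair_all_sep,
      ringStar_pair_xy_s_all, ringStar_pair_xy_s_xy_s, ringStar_pair_xy_s_xs_y, ringStar_pair_xy_s_ys_x, ringStar_pair_xy_s_sep,
      ringStar_pair_xs_y_all, ringStar_pair_xs_y_xy_s, ringStar_pair_xs_y_xs_y, ringStar_pair_xs_y_ys_x, ringStar_pair_xs_y_sep,
      ringStar_pair_ys_x_all, ringStar_pair_ys_x_xy_s, ringStar_pair_ys_x_xs_y, ringStar_pair_ys_x_ys_x, ringStar_pair_ys_x_sep,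
      ringStar_pair_sep_all, ringStar_pair_sep_xy_s, ringStar_pair_sep_xs_y, ringStar_pair_sep_ys_x, ringStar_pair_sep_sep]) d PK QK P1 Q1 P2 Q2

/-- **THEOREM SP (RING, target `starXTab`; census g34, kernel):** for three two-terminal series–parallel pieces in a ring `K(v,u;b)·Q₁(u,w;s)·Q₂(w,v;t)` (RING), each piece two-terminal
series–parallel between its corners with its mark inner, `0 ≤ 16 · lev2 (E_K ∪ E₁ ∪ E₂) b s t starXTab λ` at EVERY level `λ`.
[cite: AyyerLinussonRavichandran2025, §7 (p. 22)] -/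
theorem ringStar_level_nonneg {EK E₁ E₂ : Finset (Sym2 V)} {VK V₁ V₂ : Set V} {u v w b s t : V}
    (hdK1 : Disjoint EK E₁) (hdK2 : Disjoint EK E₂) (hd12 : Disjoint E₁ E₂)
    (hK : ∀ e ∈ (↑EK : Set (Sym2 V)), ∀ z ∈ e, z ∈ VK)
    (h₁ : ∀ e ∈ (↑E₁ : Set (Sym2 V)), ∀ z ∈ e, z ∈ V₁) (h₂ : ∀ e ∈ (↑E₂ : Set (Sym2 V)), ∀ z ∈ e, z ∈ V₂)
    (hK1 : VK ∩ V₁ ⊆ ({u} : Set V)) (h12 : V₁ ∩ V₂ ⊆ ({w} : Set V)) (hK2 : VK ∩ V₂ ⊆ ({v} : Set V))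
    (hu2 : u ∉ V₂) (hv1 : v ∉ V₁) (huv : u ≠ v) (huw : u ≠ w) (hvw : v ≠ w)
    (hb1 : b ∉ V₁) (hb2 : b ∉ V₂) (hsK : s ∉ VK) (hs2 : s ∉ V₂) (htK : t ∉ VK) (ht1 : t ∉ V₁)
    (hbu : b ≠ u) (hbv : b ≠ v) (hsu : s ≠ u) (hsv : s ≠ v) (hsw : s ≠ w) (htu : t ≠ u) (htv : t ≠ v) (htw : t ≠ w)
    (hbs : b ≠ s) (hbt : b ≠ t) (hst : s ≠ t)
    (hKsp : IsTTSP EK v u) (h1sp : IsTTSP E₁ u w) (h2sp : IsTTSP E₂ w v)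
    (hbK : ∃ e ∈ EK, b ∈ e) (hs1 : ∃ e ∈ E₁, s ∈ e) (ht2 : ∃ e ∈ E₂, t ∈ e)
    (lam : ℕ) : 0 ≤ ((16 : ℕ) : ℤ) * lev2 (EK ∪ E₁ ∪ E₂) b s t starXTab lam :=
  ring_level_nonneg_of_symCertG hdK1 hdK2 hd12 hK h₁ h₂ hK1 h12 hK2 hu2 hv1 huv huw hvw hb1 hb2 hsK hs2 htK ht1 hbu hbv hsu hsv hsw htu htv htw hbs hbt hst
    hKsp h1sp h2sp hbK hs1 ht2 starXTab 16 prodsRingStar ringStar_ok ringStar_cert lam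

end Data

end FK

end Summit.CriticalPhenomena.PercolationContinuityZ3.Theorems

end
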